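import Literature.NumberTheory.Sieve.BombieriAsymptoticSievePrCells
import Literature.NumberTheory.Sieve.BombieriAsymptoticSieveVectorProofs
import HarnessLib

/-!
# Bombieri's asymptotic sieve on `P_r`, min form: proofs

Topic `Literature/NumberTheory/Sieve`, family `parity`. Proof file (no named fact, no definition) which
DISCHARGES `Bombieri1976_PrDistributionMin` (`BombieriAsymptoticSievePrDistributionMin.lean`:
[BombieriRIMS1977] p. 5 Theorem for every `r ≥ 2`, test functions of the smallest prime factor),
`Bombieri1976_PrDistributionMin_holds`, at the end of the file. Route ([FriedlanderIwaniecPisa1978]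
p. 723 Remark 4, as for `r = 2` in the tree): the tree's PROVED vector Theorem 1
(`Bombieri1976_asymptotic_sieve_vector_holds`) ⟹ the law for polynomial product weights
(`BombieriAsymptoticSievePrProductLaw.lean`) ⟹ comparison with the integers and, by Alladi's theorem
for the integers (tree) and the prime number theorem, the rough cells of a Bombieri sequence
(`BombieriAsymptoticSievePrCells.lean`, `BombieriPr.roughCell_law`) ⟹ (this file) the cells in the
normalisation `u = log p/log n` (`uMass_law`: the tail `n ≤ x^{1−θ}` is controlled by the cell law at
`x^{1−θ}` and (A₄), the layer `x^{(1−θ)/V} ≤ p_min < x^{1/V}` by the continuity of `I_s`), and finally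
a continuous test function `g(u_min)` vanishing on `(−∞, η]` by uniform approximation with step functions
of `u_min` (finite combinations of cells), the weight being identified with
`bombieriMinWeight r g = ∫_1^{1/η} g(1/w) I_{r−1}(w−1)/(w−1) dw` through
`BombieriRoughCells.integral_kernel_eq` (`∫_1^V K_r = I_r(V)`).
-/

noncomputable section

open Filter Asymptotics Finset ArithmeticFunction MeasureTheory intervalIntegral
open scoped Topology ArithmeticFunction.omega

namespace Literature.NumberTheory.Sieve

open BombieriVector BombieriP2 BombieriRoughCells

namespace BombieriPr

/-! ### From `v = log p/log x` to `u = log p/log n`: the cells in the `u`-normalisation -/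

/-- Members of `P_s(x)`: basic size facts. [folklore] -/
theorem mem_Ps_facts {s : ℕ} (hs : 1 ≤ s) {x : ℝ} (hx : 1 < x) {n : ℕ} (hn : n ∈ Ps s x) :
    2 ≤ n ∧ (n : ℝ) ≤ x ∧ 0 < Real.log n ∧ Real.log n ≤ Real.log x ∧
      0 < Real.log (Nat.minFac n) ∧ (Nat.minFac n : ℝ) ≤ n := by
  have hn2 := two_le_of_mem hs hn
  obtain ⟨⟨hn1, hnN⟩, _, _⟩ := mem_Ps.mp hn
  have hx0 : 0 < x := by linarith
  have hnx : (n : ℝ) ≤ x := (Nat.cast_le.mpr hnN).trans (Nat.floor_le hx0.le)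
  have hn0 : (0 : ℝ) < n := by exact_mod_cast (by omega : 0 < n)
  have hmf := Nat.minFac_prime (by omega : n ≠ 1)
  refine ⟨hn2, hnx, Real.log_pos (by exact_mod_cast (by omega : 1 < n)), Real.log_le_log hn0 hnx,
    Real.log_pos (by exact_mod_cast hmf.one_lt), by exact_mod_cast Nat.minFac_le (by omega)⟩

/-- The sharp `v`-cell lies in the `u`-cell: `x^{1/V} ≤ p_min(n)` implies `u_min(n) ≥ 1/V`
(`n ≤ x`, `V > 0`). [folklore] -/
theorem uCond_of_vCond {s : ℕ} (hs : 1 ≤ s) {x V : ℝ} (hx : 1 < x) (hV : 0 < V) {n : ℕ}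
    (hn : n ∈ Ps s x) (h : x ^ (1 / V) ≤ (Nat.minFac n : ℝ)) :
    1 / V ≤ Real.log (Nat.minFac n) / Real.log n := by
  obtain ⟨_, _, hlogn, hlognx, _, _⟩ := mem_Ps_facts hs hx hn
  have hx0 : 0 < x := by linarith
  rw [le_div_iff₀ hlogn]
  have h1 : Real.log (x ^ (1 / V)) ≤ Real.log (Nat.minFac n) :=
    Real.log_le_log (Real.rpow_pos_of_pos hx0 _) h
  rw [Real.log_rpow hx0] at h1
  calc 1 / V * Real.log n ≤ 1 / V * Real.log x := mul_le_mul_of_nonneg_left hlognx (by positivity)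
    _ ≤ _ := h1

/-- From `u_min(n) ≥ 1/V` and `n > y` (`y ≥ 1`) to `p_min(n) > y^{1/V}`. [folklore] -/
theorem rpow_lt_minFac_of_uCond {s : ℕ} (hs : 1 ≤ s) {x V y : ℝ} (hx : 1 < x) (hV : 0 < V) (hy : 1 ≤ y)
    {n : ℕ} (hn : n ∈ Ps s x) (h : 1 / V ≤ Real.log (Nat.minFac n) / Real.log n) (hyn : y < n) :
    y ^ (1 / V) < (Nat.minFac n : ℝ) := by
  obtain ⟨_, _, hlogn, _, _, _⟩ := mem_Ps_facts hs hx hn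
  have hy0 : 0 < y := by linarith
  rw [le_div_iff₀ hlogn] at h
  have hmf0 : (0 : ℝ) < (Nat.minFac n : ℝ) := by exact_mod_cast Nat.minFac_pos n
  rw [← Real.log_lt_log_iff (Real.rpow_pos_of_pos hy0 _) hmf0, Real.log_rpow hy0]
  calc 1 / V * Real.log y < 1 / V * Real.log n :=
        mul_lt_mul_of_pos_left (Real.log_lt_log hy0 hyn) (by positivity)
    _ ≤ _ := h

set_option maxHeartbeats 400000 in
/-- **The `u`-cells of a Bombieri sequence**: for `s ≥ 1`, `V > 1`,
`∑_{n ≤ x, n ∈ P_s, p_min(n) ≥ n^{1/V}} a_n = I_s(V) M_s(x) + o(A(x)/log x)` (the condition written as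
`u_min(n) = log p_min(n)/log n ≥ 1/V`). From `roughCell_law`: the extra integers have either
`n ≤ x^{1−θ}` (mass `≤ A(x^{(1−θ)/2}) + C_s(x^{1−θ}, 2V) = o(A/log x)` by the cell law at `x^{1−θ}` and
(A₄)) or `x^{(1−θ)/V} ≤ p_min(n) < x^{1/V}` (mass `C_s(x, V/(1−θ)) − C_s(x, V)`, small by the continuity
of `I_s` at `V`). [folklore] -/
theorem uMass_law (hV : Bombieri1976_asymptotic_sieve_vector) {A : SieveSequence} {H : ℝ}
    (hA : A.IsBombieriSequence) (hH : A.HasDensityConstant H) {s : ℕ} (hs : 1 ≤ s) {V : ℝ}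
    (hV1 : 1 < V) :
    (fun x : ℝ => ∑ n ∈ (Ps s x).filter (fun n : ℕ => 1 / V ≤ Real.log (Nat.minFac n) / Real.log n),
        A.a n - roughCellDensity s V * mainTerm A H s x) =o[atTop]
      fun x : ℝ => A.size x / Real.log x := by
  have hsize := hA.1
  have hXnn : ∀ y, 0 ≤ A.size y := SieveSequence.size_nonneg_of_size_eq hsize
  obtain ⟨K₃, hK₃0, hK₃⟩ := abs_mainTerm_eventually hA hH s
  have hV0 : 0 < V := by linarith
  set I : ℝ := roughCellDensity s V with hI
  have hI0 : 0 ≤ I := roughCellDensity_nonneg s V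
  set I2 : ℝ := roughCellDensity s (2 * V) with hI2
  have hI20 : 0 ≤ I2 := roughCellDensity_nonneg s (2 * V)
  rw [isLittleO_iff]
  intro c hc
  -- continuity window and `θ`
  set ε₁ : ℝ := c / (8 * (K₃ + 1)) with hε₁
  have hε₁0 : 0 < ε₁ := by positivity
  have hε₁K : ε₁ * K₃ ≤ c / 8 := by
    rw [hε₁, div_mul_eq_mul_div, div_le_div_iff₀ (by positivity) (by norm_num)]; nlinarith
  obtain ⟨δ, hδ0, hδ⟩ := Metric.continuousAt_iff.mp (continuousAt_roughCellDensity s hV1) ε₁ hε₁0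
  set θ : ℝ := min (1 / 2) (δ / (4 * V)) with hθ
  have hθ0 : 0 < θ := lt_min (by norm_num) (by positivity)
  have hθ2 : θ ≤ 1 / 2 := min_le_left _ _
  have hθ1 : θ < 1 := by linarith
  have h1θ : 0 < 1 - θ := by linarith
  set V' : ℝ := V / (1 - θ) with hV'
  have hVV' : V < V' := by
    rw [hV', lt_div_iff₀ h1θ]; nlinarith
  have hV'1 : 1 < V' := lt_trans hV1 hVV'
  have hV'V : V' - V < δ := by
    have e : V' - V = V * θ / (1 - θ) := by rw [hV']; field_simp; ring
    rw [e, div_lt_iff₀ h1θ]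
    have h1 : V * θ ≤ δ / 4 := by
      calc V * θ ≤ V * (δ / (4 * V)) := mul_le_mul_of_nonneg_left (min_le_right _ _) hV0.le
        _ = δ / 4 := by field_simp
    nlinarith
  have hIV' : |roughCellDensity s V' - I| < ε₁ := by
    have h := hδ (x := V') (by rw [Real.dist_eq, abs_of_pos (by linarith)]; exact hV'V)
    rwa [Real.dist_eq] at h
  -- the eventual inputs
  set ε₂ : ℝ := c / 8 with hε₂
  have hε₂0 : 0 < ε₂ := by positivity
  have hcV := (roughCell_law hV hA hH hs hV1).def hε₂0
  have hcV' := (roughCell_law hV hA hH hs hV'1).def hε₂0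
  have h2V : 1 < 2 * V := by linarith
  have htend : Tendsto (fun x : ℝ => x ^ (1 - θ)) atTop atTop := tendsto_rpow_atTop h1θ
  have hc2V := htend.eventually ((roughCell_law hV hA hH hs h2V).def one_pos)
  have hK₃' := htend.eventually hK₃
  have hsq' := htend.eventually ((size_sqrt_isLittleO hA).def one_pos)
  set ε₃ : ℝ := c * (1 - θ) / (8 * (I2 * K₃ + 3)) with hε₃
  have hε₃0 : 0 < ε₃ := by positivity
  have hsz := (size_rpow_isLittleO hA hθ0 hθ1).def hε₃0
  filter_upwards [hK₃, hcV, hcV', hc2V, hK₃', hsq', hsz, eventually_gt_atTop (1 : ℝ),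
    htend.eventually (eventually_gt_atTop (1 : ℝ))] with x hxK hxc hxc' hxc2 hxK' hxsq hxsz hx1 hx1'
  have hx0 : 0 < x := by linarith
  have hL : 0 < Real.log x := Real.log_pos hx1
  set x' : ℝ := x ^ (1 - θ) with hx'
  have hx'0 : 0 < x' := by positivity
  have hL' : Real.log x' = (1 - θ) * Real.log x := by rw [hx', Real.log_rpow hx0]
  have hL'0 : 0 < Real.log x' := by rw [hL']; positivity
  have hx'x : x' ≤ x := by rw [hx']; exact Real.rpow_le_self_of_one_le hx1.le (by linarith)
  have hAL : 0 ≤ A.size x / Real.log x := div_nonneg (hXnn x) hL.le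
  have hAL' : 0 ≤ A.size x' / Real.log x' := div_nonneg (hXnn x') hL'0.le
  rw [Real.norm_eq_abs, Real.norm_eq_abs, abs_of_nonneg hAL] at hxc hxc' ⊢
  rw [Real.norm_eq_abs, Real.norm_eq_abs, abs_of_nonneg hAL', one_mul] at hxc2
  rw [Real.norm_eq_abs, Real.norm_eq_abs, abs_of_nonneg (hXnn _), abs_of_nonneg hAL', one_mul] at hxsq
  rw [Real.norm_eq_abs, Real.norm_eq_abs, abs_of_nonneg (hXnn _), abs_of_nonneg (hXnn _)] at hxsz
  -- the decomposition of the `u`-cell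
  set U := (Ps s x).filter (fun n : ℕ => 1 / V ≤ Real.log (Nat.minFac n) / Real.log n) with hU
  set cellV : ℕ → Prop := fun n => x ^ (1 / V) ≤ (Nat.minFac n : ℝ) with hcellV
  set cellV' : ℕ → Prop := fun n => x ^ (1 / V') ≤ (Nat.minFac n : ℝ) with hcellV'
  have hsplit := (Finset.sum_filter_add_sum_filter_not U cellV A.a).symm
  -- part inside the `v`-cell equals `C_s(x, V)`
  have hin : ∑ n ∈ U.filter cellV, A.a n = roughCell A s V x := by
    have e : U.filter cellV = (Ps s x).filter cellV := by
      rw [hU, Finset.filter_filter]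
      exact Finset.filter_congr fun n hn => ⟨fun h => h.2, fun h => ⟨uCond_of_vCond hs hx1 hV0 hn h, h⟩⟩
    rw [e]
    rfl
  -- part outside: split at `⌊x'⌋`
  have hout : ∑ n ∈ U.filter (fun n => ¬ cellV n), A.a n ≤
      (roughCell A s V' x - roughCell A s V x) + (A.size (Real.sqrt x') + roughCell A s (2 * V) x') := by
    rw [← Finset.sum_filter_add_sum_filter_not (U.filter (fun n => ¬ cellV n)) (fun n : ℕ => n ≤ ⌊x'⌋₊)]
    rw [add_comm]
    refine add_le_add ?_ ?_
    · -- `n > x'`: in `cell_{V'} \ cell_V`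
      have hnest : ∀ n, cellV n → x ^ (1 / V') ≤ (Nat.minFac n : ℝ) := fun n h =>
        le_trans (Real.rpow_le_rpow_of_exponent_le hx1.le
          (one_div_le_one_div_of_le hV0 hVV'.le)) h
      have hdiff : roughCell A s V' x - roughCell A s V x =
          ∑ n ∈ ((Ps s x).filter cellV').filter (fun n => ¬ cellV n), A.a n := by
        have h := Finset.sum_filter_add_sum_filter_not ((Ps s x).filter cellV') cellV A.a
        have e1 : ((Ps s x).filter cellV').filter cellV = (Ps s x).filter cellV := by
          rw [Finset.filter_filter]
          exact Finset.filter_congr fun n _ => ⟨fun h => h.2, fun h => ⟨hnest n h, h⟩⟩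
        rw [e1] at h
        have e2 : roughCell A s V' x = ∑ n ∈ (Ps s x).filter cellV', A.a n := rfl
        have e3 : roughCell A s V x = ∑ n ∈ (Ps s x).filter cellV, A.a n := rfl
        rw [e2, e3, ← h]
        ring
      rw [hdiff]
      refine Finset.sum_le_sum_of_subset_of_nonneg (fun n hn => ?_) fun n _ _ => A.a_nonneg n
      simp only [Finset.mem_filter, hU] at hn ⊢
      obtain ⟨⟨⟨hnP, hu⟩, hnc⟩, hnx'⟩ := hn
      refine ⟨⟨hnP, ?_⟩, hnc⟩
      have hn_gt : x' < n := by
        have : ⌊x'⌋₊ < n := not_le.mp hnx'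
        calc x' < (⌊x'⌋₊ : ℝ) + 1 := Nat.lt_floor_add_one x'
          _ ≤ n := by exact_mod_cast this
      have h := rpow_lt_minFac_of_uCond hs hx1 hV0 (Real.one_le_rpow hx1.le h1θ.le) hnP hu hn_gt
      have e : x ^ (1 / V') = x' ^ (1 / V) := by
        rw [hx', ← Real.rpow_mul hx0.le]
        congr 1
        rw [hV']
        field_simp
      show x ^ (1 / V') ≤ (Nat.minFac n : ℝ)
      rw [e]
      exact h.le
    · -- `n ≤ x'`: in the `u`-cell at `x'`, which is inside `{n ≤ √x'} ∪ cell(x', 2V)`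
      calc ∑ n ∈ (U.filter (fun n => ¬ cellV n)).filter (fun n : ℕ => n ≤ ⌊x'⌋₊), A.a n
          ≤ ∑ n ∈ (Ps s x').filter (fun n : ℕ => 1 / V ≤ Real.log (Nat.minFac n) / Real.log n), A.a n := by
            refine Finset.sum_le_sum_of_subset_of_nonneg (fun n hn => ?_) fun n _ _ => A.a_nonneg n
            simp only [Finset.mem_filter, hU] at hn ⊢
            obtain ⟨⟨⟨hnP, hu⟩, _⟩, hnx'⟩ := hn
            obtain ⟨⟨hn1, _⟩, hsq, hcard⟩ := mem_Ps.mp hnP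
            exact ⟨mem_Ps.mpr ⟨⟨hn1, hnx'⟩, hsq, hcard⟩, hu⟩
        _ ≤ A.size (Real.sqrt x') + roughCell A s (2 * V) x' := by
            rw [← Finset.sum_filter_add_sum_filter_not _ (fun n : ℕ => (n : ℝ) ≤ Real.sqrt x')]
            refine add_le_add ?_ ?_
            · refine sum_le_size hsize fun n hn => ?_
              simp only [Finset.mem_filter] at hn
              obtain ⟨⟨hnP, _⟩, hns⟩ := hn
              obtain ⟨⟨hn1, _⟩, _, _⟩ := mem_Ps.mp hnP
              exact Finset.mem_Ioc.mpr ⟨hn1, Nat.le_floor hns⟩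
            · rw [roughCell]
              refine Finset.sum_le_sum_of_subset_of_nonneg (fun n hn => ?_) fun n _ _ => A.a_nonneg n
              simp only [Finset.mem_filter] at hn ⊢
              obtain ⟨⟨hnP, hu⟩, hns⟩ := hn
              refine ⟨by simpa [Ps] using hnP, ?_⟩
              have hsx : Real.sqrt x' < n := not_le.mp hns
              have h := rpow_lt_minFac_of_uCond hs hx1' hV0 (Real.one_le_sqrt.mpr (Real.one_le_rpow hx1.le h1θ.le))
                hnP hu hsx
              rw [Real.sqrt_eq_rpow, ← Real.rpow_mul hx'0.le] at h
              rw [show 1 / (2 * V) = 1 / 2 * (1 / V) by field_simp]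
              exact h.le
  -- numeric bounds
  have hcell0 : 0 ≤ ∑ n ∈ U.filter (fun n => ¬ cellV n), A.a n := Finset.sum_nonneg fun n _ => A.a_nonneg n
  have hM : |mainTerm A H s x| ≤ K₃ * A.size x / Real.log x := hxK
  have hM' : |mainTerm A H s x'| ≤ K₃ * A.size x' / Real.log x' := hxK'
  have h1 : roughCell A s V' x - roughCell A s V x ≤ ε₁ * K₃ * (A.size x / Real.log x) +
      2 * ε₂ * (A.size x / Real.log x) := by
    have ha := (abs_le.mp hxc').2
    have hb := (abs_le.mp hxc).1
    have hd : roughCellDensity s V' * mainTerm A H s x - I * mainTerm A H s x ≤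
        ε₁ * K₃ * (A.size x / Real.log x) :=
      calc roughCellDensity s V' * mainTerm A H s x - I * mainTerm A H s x
          = (roughCellDensity s V' - I) * mainTerm A H s x := by ring
        _ ≤ |(roughCellDensity s V' - I) * mainTerm A H s x| := le_abs_self _
        _ = |roughCellDensity s V' - I| * |mainTerm A H s x| := abs_mul _ _
        _ ≤ ε₁ * (K₃ * A.size x / Real.log x) := mul_le_mul hIV'.le hM (abs_nonneg _) hε₁0.le
        _ = ε₁ * K₃ * (A.size x / Real.log x) := by ring
    linarith
  have h2 : A.size (Real.sqrt x') ≤ ε₃ / (1 - θ) * (A.size x / Real.log x) := by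
    calc A.size (Real.sqrt x') ≤ A.size x' / Real.log x' := hxsq
      _ ≤ ε₃ * A.size x / Real.log x' := div_le_div_of_nonneg_right hxsz hL'0.le
      _ = ε₃ / (1 - θ) * (A.size x / Real.log x) := by rw [hL']; field_simp
  have h3 : roughCell A s (2 * V) x' ≤ (I2 * K₃ + 1) * (ε₃ / (1 - θ)) * (A.size x / Real.log x) := by
    have ha := (abs_le.mp hxc2).2
    have hb : I2 * mainTerm A H s x' ≤ I2 * (K₃ * A.size x' / Real.log x') :=
      mul_le_mul_of_nonneg_left ((le_abs_self _).trans hM') hI20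
    calc roughCell A s (2 * V) x' ≤ (I2 * K₃ + 1) * (A.size x' / Real.log x') := by
          have e1 : I2 * (K₃ * A.size x' / Real.log x') = I2 * K₃ * (A.size x' / Real.log x') := by ring
          have e2 : (I2 * K₃ + 1) * (A.size x' / Real.log x') =
              I2 * K₃ * (A.size x' / Real.log x') + A.size x' / Real.log x' := by ring
          linarith
      _ ≤ (I2 * K₃ + 1) * (ε₃ * A.size x / Real.log x') :=
          mul_le_mul_of_nonneg_left (div_le_div_of_nonneg_right hxsz hL'0.le) (by positivity)
      _ = (I2 * K₃ + 1) * (ε₃ / (1 - θ)) * (A.size x / Real.log x) := by rw [hL']; field_simp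
  have hε₃' : (I2 * K₃ + 2) * (ε₃ / (1 - θ)) ≤ c / 8 := by
    rw [hε₃]
    rw [show (I2 * K₃ + 2) * (c * (1 - θ) / (8 * (I2 * K₃ + 3)) / (1 - θ)) =
      c / 8 * ((I2 * K₃ + 2) / (I2 * K₃ + 3)) by field_simp]
    calc c / 8 * ((I2 * K₃ + 2) / (I2 * K₃ + 3)) ≤ c / 8 * 1 := by
          refine mul_le_mul_of_nonneg_left ?_ (by positivity)
          rw [div_le_one (by positivity)]; linarith
      _ = c / 8 := mul_one _
  -- assemble
  rw [hsplit, hin]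
  have hcellV : |roughCell A s V x - I * mainTerm A H s x| ≤ ε₂ * (A.size x / Real.log x) := hxc
  have hrest : ∑ n ∈ U.filter (fun n => ¬ cellV n), A.a n ≤ (c / 2) * (A.size x / Real.log x) := by
    have e : ε₃ / (1 - θ) * (A.size x / Real.log x) + (I2 * K₃ + 1) * (ε₃ / (1 - θ)) * (A.size x / Real.log x)
        = (I2 * K₃ + 2) * (ε₃ / (1 - θ)) * (A.size x / Real.log x) := by ring
    have h4 : (I2 * K₃ + 2) * (ε₃ / (1 - θ)) * (A.size x / Real.log x) ≤ c / 8 * (A.size x / Real.log x) :=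
      mul_le_mul_of_nonneg_right hε₃' hAL
    have h5 : ε₁ * K₃ * (A.size x / Real.log x) ≤ c / 8 * (A.size x / Real.log x) :=
      mul_le_mul_of_nonneg_right hε₁K hAL
    rw [hε₂] at h1
    linarith [hout, h1, h2, h3, h4, h5]
  rw [abs_le] at hcellV ⊢
  rw [hε₂] at hcellV
  have hcA : 0 ≤ c * (A.size x / Real.log x) := mul_nonneg hc.le hAL
  constructor <;> linarith [hcellV.1, hcellV.2, hrest, hcell0]


/-! ### The cells in the variable `v = log n/log p_min(n)` -/

/-- For `s ≥ 2` a member `n` of `P_s` is not prime, so `p_min(n)² ≤ n` and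
`v(n) = log n/log p_min(n) ≥ 2`. [folklore] -/
theorem two_le_vmin {s : ℕ} (hs : 2 ≤ s) {x : ℝ} (hx : 1 < x) {n : ℕ} (hn : n ∈ Ps s x) :
    2 ≤ Real.log n / Real.log (Nat.minFac n) := by
  obtain ⟨hn2, _, _, _, hlogmf, _⟩ := mem_Ps_facts (by omega) hx hn
  obtain ⟨_, _, hcard⟩ := mem_Ps.mp hn
  have hnp : ¬ n.Prime := by
    intro hp
    rw [Nat.Prime.primeFactors hp, Finset.card_singleton] at hcard
    omega
  have hsq : n.minFac ^ 2 ≤ n := Nat.minFac_sq_le_self (by omega) hnp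
  have hmf0 : (0 : ℝ) < Nat.minFac n := by exact_mod_cast Nat.minFac_pos n
  have h : ((Nat.minFac n : ℝ)) ^ 2 ≤ n := by exact_mod_cast hsq
  have hlog : 2 * Real.log (Nat.minFac n) ≤ Real.log n := by
    have e : Real.log ((Nat.minFac n : ℝ) ^ 2) = 2 * Real.log (Nat.minFac n) := by
      rw [Real.log_pow]; push_cast; ring
    rw [← e]
    exact Real.log_le_log (by positivity) h
  rwa [le_div_iff₀ hlogmf]

/-- The `u`-condition in `v`-form: for `n ∈ P_s ∩ [1, x]` (`x > 1`) and `V > 0`,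
`1/V ≤ log p_min(n)/log n ↔ log n/log p_min(n) ≤ V`. [folklore] -/
theorem uCond_iff_vCond {s : ℕ} (hs : 1 ≤ s) {x V : ℝ} (hx : 1 < x) (hV : 0 < V) {n : ℕ}
    (hn : n ∈ Ps s x) :
    1 / V ≤ Real.log (Nat.minFac n) / Real.log n ↔ Real.log n / Real.log (Nat.minFac n) ≤ V := by
  obtain ⟨_, _, hlogn, _, hlogmf, _⟩ := mem_Ps_facts hs hx hn
  rw [one_div_le hV (div_pos hlogmf hlogn), one_div_div]

/-- **The `v`-cells of a Bombieri sequence** (`s ≥ 2`, `V ≥ 1`):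
`∑_{n ≤ x, n ∈ P_s, log n/log p_min(n) ≤ V} a_n = I_s(V) M_s(x) + o(A(x)/log x)`; for `V = 1` both
sides vanish identically (`v(n) ≥ 2` and `I_s(1) = 0`). [folklore] -/
theorem vMass_law (hV : Bombieri1976_asymptotic_sieve_vector) {A : SieveSequence} {H : ℝ}
    (hA : A.IsBombieriSequence) (hH : A.HasDensityConstant H) {s : ℕ} (hs : 2 ≤ s) {V : ℝ}
    (hV1 : 1 ≤ V) :
    (fun x : ℝ => ∑ n ∈ (Ps s x).filter (fun n : ℕ => Real.log n / Real.log (Nat.minFac n) ≤ V),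
        A.a n - roughCellDensity s V * mainTerm A H s x) =o[atTop]
      fun x : ℝ => A.size x / Real.log x := by
  rcases hV1.eq_or_lt with h | h
  · subst h
    refine (isLittleO_zero (fun x : ℝ => A.size x / Real.log x) atTop).congr' ?_ EventuallyEq.rfl
    filter_upwards [eventually_gt_atTop 1] with x hx
    rw [roughCellDensity_of_le hs (by exact_mod_cast (by omega : 1 ≤ s)), zero_mul, sub_zero]
    symm
    refine Finset.sum_eq_zero fun n hn => ?_
    exfalso
    rw [Finset.mem_filter] at hn
    have := two_le_vmin hs hx hn.1
    linarith [hn.2]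
  · refine (uMass_law hV hA hH (s := s) (by omega) h).congr' ?_ EventuallyEq.rfl
    filter_upwards [eventually_gt_atTop 1] with x hx
    rw [Finset.filter_congr fun n hn => uCond_iff_vCond (s := s) (by omega) hx (by linarith) hn]

/-! ### Step functions of `v` on the partition `w_k = 1 + kΔ` of `[1, M]` -/

/-- The cell index of a point `v ∈ (1, 1 + NΔ]`: the `k₀ < N` with `w_{k₀} < v ≤ w_{k₀+1}`.
[folklore] -/
theorem cell_index {Δ : ℝ} (hΔ : 0 < Δ) {N : ℕ} {v : ℝ} (hv1 : 1 < v) (hvN : v ≤ 1 + N * Δ) :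
    ∃ k₀ : ℕ, k₀ < N ∧ 1 + k₀ * Δ < v ∧ v ≤ 1 + (k₀ + 1 : ℕ) * Δ := by
  set t : ℝ := (v - 1) / Δ with ht
  have ht0 : 0 < t := div_pos (by linarith) hΔ
  have htN : t ≤ N := by rw [ht, div_le_iff₀ hΔ]; linarith
  have hm1 : 0 < ⌈t⌉₊ := Nat.ceil_pos.mpr ht0
  have hmN : ⌈t⌉₊ ≤ N := Nat.ceil_le.mpr htN
  refine ⟨⌈t⌉₊ - 1, by omega, ?_, ?_⟩
  · have h1 : ((⌈t⌉₊ - 1 : ℕ) : ℝ) < t := Nat.lt_ceil.mp (by omega)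
    rw [ht, lt_div_iff₀ hΔ] at h1
    linarith
  · have h2 : t ≤ ((⌈t⌉₊ - 1 + 1 : ℕ) : ℝ) := by
      rw [Nat.sub_add_cancel (by omega : 1 ≤ ⌈t⌉₊)]
      exact Nat.le_ceil t
    rw [ht, div_le_iff₀ hΔ] at h2
    linarith

/-- Evaluation of the step function `∑_{k<N} c_k (1_{v ≤ w_{k+1}} − 1_{v ≤ w_k})` (with a weight `a`)
at a point of the cell `(w_{k₀}, w_{k₀+1}]`: only the term `k = k₀` survives. [folklore] -/
theorem step_eval {Δ : ℝ} (hΔ : 0 < Δ) {N k₀ : ℕ} (hk₀ : k₀ < N) {v : ℝ} (h1 : 1 + k₀ * Δ < v)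
    (h2 : v ≤ 1 + (k₀ + 1 : ℕ) * Δ) (c : ℕ → ℝ) (a : ℝ) :
    ∑ k ∈ Finset.range N, c k * ((if v ≤ 1 + (k + 1 : ℕ) * Δ then a else 0) -
      (if v ≤ 1 + k * Δ then a else 0)) = c k₀ * a := by
  rw [Finset.sum_eq_single_of_mem k₀ (Finset.mem_range.mpr hk₀)]
  · rw [if_pos h2, if_neg (not_le.mpr h1), sub_zero]
  · intro j _ hjk
    rcases lt_or_gt_of_ne hjk with hlt | hgt
    · -- `j < k₀`: both conditions fail
      have hj1 : ((j + 1 : ℕ) : ℝ) ≤ k₀ := by exact_mod_cast hlt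
      have hj0 : (j : ℝ) ≤ k₀ := by exact_mod_cast hlt.le
      have hj1' := mul_le_mul_of_nonneg_right hj1 hΔ.le
      have hj0' := mul_le_mul_of_nonneg_right hj0 hΔ.le
      have e1 : ¬ v ≤ 1 + ((j + 1 : ℕ) : ℝ) * Δ := not_le.mpr (lt_of_le_of_lt (by linarith) h1)
      have e2 : ¬ v ≤ 1 + (j : ℝ) * Δ := not_le.mpr (lt_of_le_of_lt (by linarith) h1)
      rw [if_neg e1, if_neg e2, sub_zero, mul_zero]
    · -- `k₀ < j`: both conditions hold
      have hj1 : ((k₀ + 1 : ℕ) : ℝ) ≤ j := by exact_mod_cast hgt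
      have hj2 : ((k₀ + 1 : ℕ) : ℝ) ≤ ((j + 1 : ℕ) : ℝ) := by exact_mod_cast (by omega)
      have hj1' := mul_le_mul_of_nonneg_right hj1 hΔ.le
      have hj2' := mul_le_mul_of_nonneg_right hj2 hΔ.le
      have e1 : v ≤ 1 + ((j + 1 : ℕ) : ℝ) * Δ := h2.trans (by linarith)
      have e2 : v ≤ 1 + (j : ℝ) * Δ := h2.trans (by linarith)
      rw [if_pos e1, if_pos e2, sub_self, mul_zero]

/-- Uniform continuity of `w ↦ g(1/w)` on `[1, M]` for a continuous `g`. [folklore] -/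
theorem unifCont_comp_inv {g : ℝ → ℝ} (hg : Continuous g) {M : ℝ} {ε : ℝ} (hε : 0 < ε) :
    ∃ τ : ℝ, 0 < τ ∧ ∀ w ∈ Set.Icc (1 : ℝ) M, ∀ w' ∈ Set.Icc (1 : ℝ) M, |w - w'| ≤ τ →
      |g (1 / w) - g (1 / w')| ≤ ε := by
  have hcont : ContinuousOn (fun w : ℝ => g (1 / w)) (Set.Icc 1 M) := by
    refine hg.comp_continuousOn ((continuousOn_const.div continuousOn_id) fun w hw => ?_)
    have : (1 : ℝ) ≤ w := hw.1
    exact ne_of_gt (by simp only [id]; linarith)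
  obtain ⟨τ, hτ0, hτ⟩ := Metric.uniformContinuousOn_iff_le.mp
    (isCompact_Icc.uniformContinuousOn_of_continuous hcont) ε hε
  refine ⟨τ, hτ0, fun w hw w' hw' hd => ?_⟩
  have := hτ w hw w' hw' (by rwa [Real.dist_eq])
  rwa [Real.dist_eq] at this

/-- **The `P_s`-sum against a step function of `v`** (`s ≥ 2`, `x > 1`): with `w_k = 1 + kΔ`,
`U_k = ∑_{n ∈ P_s ∩ [1,x], v(n) ≤ w_k} a_n`, `1 + NΔ = M ≥ 1/η`, and `|g(1/w) − g(1/w')| ≤ ε` whenever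
`w, w' ∈ [1, M]`, `|w − w'| ≤ τ` (`Δ ≤ τ`):
`|S_s(g; x) − ∑_{k<N} g(1/w_{k+1}) (U_{k+1} − U_k)| ≤ ε U_N`. Each `n` with `v(n) ≤ M` lies in exactly one
cell `(w_k, w_{k+1}]`, where `|g(1/v(n)) − g(1/w_{k+1})| ≤ ε`; for `v(n) > M`, `g(1/v(n)) = 0`. [folklore] -/
theorem prSum_step_approx {s : ℕ} (hs : 2 ≤ s) {g : ℝ → ℝ} {η : ℝ} (hη : 0 < η)
    (hgη : ∀ u, u ≤ η → g u = 0) {M : ℝ} (hMη : 1 / η ≤ M) {N : ℕ} {Δ : ℝ} (hΔ : 0 < Δ)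
    (hNΔ : 1 + N * Δ = M) {ε τ : ℝ}
    (hτ : ∀ w ∈ Set.Icc (1 : ℝ) M, ∀ w' ∈ Set.Icc (1 : ℝ) M, |w - w'| ≤ τ →
      |g (1 / w) - g (1 / w')| ≤ ε)
    (hΔτ : Δ ≤ τ) (A : SieveSequence) {x : ℝ} (hx : 1 < x) :
    |prSum A s g x - ∑ k ∈ Finset.range N, g (1 / (1 + (k + 1 : ℕ) * Δ)) *
        ((∑ n ∈ (Ps s x).filter
            (fun n : ℕ => Real.log n / Real.log (Nat.minFac n) ≤ 1 + (k + 1 : ℕ) * Δ), A.a n) -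
          ∑ n ∈ (Ps s x).filter
            (fun n : ℕ => Real.log n / Real.log (Nat.minFac n) ≤ 1 + k * Δ), A.a n)| ≤
      ε * ∑ n ∈ (Ps s x).filter
        (fun n : ℕ => Real.log n / Real.log (Nat.minFac n) ≤ 1 + N * Δ), A.a n := by
  have hM0 : 0 < M := by rw [← hNΔ]; positivity
  have hMη' : 1 / M ≤ η := (one_div_le hM0 hη).mpr hMη
  have hP : prSum A s g x = ∑ n ∈ Ps s x, A.a n * g (Real.log (Nat.minFac n) / Real.log n) := rfl
  rw [hP]
  simp only [Finset.sum_filter]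
  -- swap the double sum
  have hswap : ∑ k ∈ Finset.range N, g (1 / (1 + (k + 1 : ℕ) * Δ)) *
      ((∑ n ∈ Ps s x,
          if Real.log n / Real.log (Nat.minFac n) ≤ 1 + (k + 1 : ℕ) * Δ then A.a n else 0) -
        ∑ n ∈ Ps s x, if Real.log n / Real.log (Nat.minFac n) ≤ 1 + k * Δ then A.a n else 0) =
      ∑ n ∈ Ps s x, ∑ k ∈ Finset.range N, g (1 / (1 + (k + 1 : ℕ) * Δ)) *
        ((if Real.log n / Real.log (Nat.minFac n) ≤ 1 + (k + 1 : ℕ) * Δ then A.a n else 0) -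
          (if Real.log n / Real.log (Nat.minFac n) ≤ 1 + k * Δ then A.a n else 0)) := by
    rw [Finset.sum_comm]
    refine Finset.sum_congr rfl fun k _ => ?_
    rw [← Finset.sum_sub_distrib, Finset.mul_sum]
  rw [hswap, ← Finset.sum_sub_distrib, Finset.mul_sum]
  refine (Finset.abs_sum_le_sum_abs _ _).trans (Finset.sum_le_sum fun n hn => ?_)
  -- pointwise in `n`
  obtain ⟨_, _, hlogn, _, hlogmf, _⟩ := mem_Ps_facts (by omega) hx hn
  have hv2 := two_le_vmin hs hx hn
  have ha := A.a_nonneg n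
  set v : ℝ := Real.log n / Real.log (Nat.minFac n) with hv
  have hgv : g (Real.log (Nat.minFac n) / Real.log n) = g (1 / v) := by rw [hv, one_div_div]
  rw [hgv]
  by_cases hvM : v ≤ 1 + N * Δ
  · obtain ⟨k₀, hk₀N, h1, h2⟩ := cell_index hΔ (by linarith) hvM
    rw [step_eval hΔ hk₀N h1 h2, if_pos hvM]
    have hwlo : (1 : ℝ) ≤ 1 + ((k₀ + 1 : ℕ) : ℝ) * Δ := by
      have : (0 : ℝ) ≤ ((k₀ + 1 : ℕ) : ℝ) * Δ := by positivity
      linarith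
    have hwhi : 1 + ((k₀ + 1 : ℕ) : ℝ) * Δ ≤ M := by
      have : ((k₀ + 1 : ℕ) : ℝ) ≤ N := by exact_mod_cast hk₀N
      have := mul_le_mul_of_nonneg_right this hΔ.le
      linarith
    have hd : |v - (1 + ((k₀ + 1 : ℕ) : ℝ) * Δ)| ≤ τ := by
      rw [abs_sub_comm, abs_of_nonneg (by linarith)]
      have : ((k₀ + 1 : ℕ) : ℝ) * Δ = k₀ * Δ + Δ := by push_cast; ring
      linarith
    have hgd := hτ v ⟨by linarith, hvM.trans hNΔ.le⟩ _ ⟨hwlo, hwhi⟩ hd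
    rw [show A.a n * g (1 / v) - g (1 / (1 + ((k₀ + 1 : ℕ) : ℝ) * Δ)) * A.a n =
      (g (1 / v) - g (1 / (1 + ((k₀ + 1 : ℕ) : ℝ) * Δ))) * A.a n by ring, abs_mul, abs_of_nonneg ha]
    exact mul_le_mul_of_nonneg_right hgd ha
  · -- `v > M`: everything vanishes
    have hvM' : M < v := by rw [← hNΔ]; exact not_le.mp hvM
    have hg0 : g (1 / v) = 0 :=
      hgη _ ((one_div_le_one_div_of_le hM0 hvM'.le).trans hMη')
    have hz : ∑ k ∈ Finset.range N, g (1 / (1 + ((k + 1 : ℕ) : ℝ) * Δ)) *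
        ((if v ≤ 1 + ((k + 1 : ℕ) : ℝ) * Δ then A.a n else 0) -
          (if v ≤ 1 + (k : ℝ) * Δ then A.a n else 0)) = 0 := by
      refine Finset.sum_eq_zero fun k hk => ?_
      have hkN : k + 1 ≤ N := Finset.mem_range.mp hk
      have e1 : ¬ v ≤ 1 + ((k + 1 : ℕ) : ℝ) * Δ := by
        refine not_le.mpr (lt_of_le_of_lt ?_ hvM')
        have : ((k + 1 : ℕ) : ℝ) ≤ N := by exact_mod_cast hkN
        have := mul_le_mul_of_nonneg_right this hΔ.le
        linarith
      have e2 : ¬ v ≤ 1 + (k : ℝ) * Δ := by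
        refine not_le.mpr (lt_of_le_of_lt ?_ hvM')
        have : (k : ℝ) ≤ N := by exact_mod_cast (by omega : k ≤ N)
        have := mul_le_mul_of_nonneg_right this hΔ.le
        linarith
      rw [if_neg e1, if_neg e2, sub_zero, mul_zero]
    rw [hz, hg0, if_neg hvM, mul_zero, mul_zero, sub_zero, abs_zero]

/-- **The weight against a step function** (`s ≥ 2`): with `w_k = 1 + kΔ`, `1 + NΔ = M ≥ max(1, 1/η)`,
`|Φ_s(g) − ∑_{k<N} g(1/w_{k+1}) (I_s(w_{k+1}) − I_s(w_k))| ≤ ε I_s(M)` when `|g(1/w) − g(1/w')| ≤ ε`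
for `w, w' ∈ [1, M]` with `|w − w'| ≤ τ` (`Δ ≤ τ`): `Φ_s(g) = ∫_1^M g(1/w) K_s(w) dw`
(`weight_eq_intervalIntegral`) and `∫_{w_k}^{w_{k+1}} K_s = I_s(w_{k+1}) − I_s(w_k)`
(`integral_kernel_eq`). [folklore] -/
theorem weight_step_approx {s : ℕ} (hs : 2 ≤ s) {g : ℝ → ℝ} (hg : Continuous g) {η : ℝ}
    (hη : 0 < η) (hgη : ∀ u, u ≤ η → g u = 0) {M : ℝ} (hM1 : 1 ≤ M) (hMη : 1 / η ≤ M) {N : ℕ}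
    {Δ : ℝ} (hΔ : 0 < Δ) (hNΔ : 1 + N * Δ = M) {ε τ : ℝ}
    (hτ : ∀ w ∈ Set.Icc (1 : ℝ) M, ∀ w' ∈ Set.Icc (1 : ℝ) M, |w - w'| ≤ τ →
      |g (1 / w) - g (1 / w')| ≤ ε)
    (hΔτ : Δ ≤ τ) :
    |bombieriMinWeight s g - ∑ k ∈ Finset.range N, g (1 / (1 + (k + 1 : ℕ) * Δ)) *
        (roughCellDensity s (1 + (k + 1 : ℕ) * Δ) - roughCellDensity s (1 + k * Δ))| ≤
      ε * roughCellDensity s M := by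
  set w : ℕ → ℝ := fun k => 1 + (k : ℝ) * Δ with hw
  have hw1 : ∀ k, 1 ≤ w k := fun k => by
    have : (0 : ℝ) ≤ k * Δ := by positivity
    simp only [hw]
    linarith
  have hwM : ∀ k, k ≤ N → w k ≤ M := fun k hk => by
    have : (k : ℝ) ≤ N := by exact_mod_cast hk
    have := mul_le_mul_of_nonneg_right this hΔ.le
    simp only [hw]
    linarith
  have hwsucc : ∀ k : ℕ, w (k + 1) = w k + Δ := fun k => by simp only [hw]; push_cast; ring
  -- `Φ = ∫_{w 0}^{w N}`
  have hΦ : bombieriMinWeight s g = ∫ t in (w 0)..(w N), g (1 / t) * kernel s t := by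
    rw [weight_eq_intervalIntegral hη hgη hM1 hMη]
    simp only [hw, Nat.cast_zero, zero_mul, add_zero, hNΔ]
  have hadj := intervalIntegral.sum_integral_adjacent_intervals
    (f := fun t => g (1 / t) * kernel s t) (μ := volume) (a := w) (n := N)
    fun k _ => intervalIntegrable_integrand hs hg hgη (hw1 k) (hw1 (k + 1))
  -- `I(w (k+1)) − I(w k) = ∫_{w k}^{w (k+1)} K`
  have hI : ∀ k, roughCellDensity s (w (k + 1)) - roughCellDensity s (w k) =
      ∫ t in (w k)..(w (k + 1)), kernel s t := fun k => by
    rw [← integral_kernel_eq hs, ← integral_kernel_eq hs,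
      integral_interval_sub_left (intervalIntegrable_kernel hs _ _) (intervalIntegrable_kernel hs _ _)]
  have hgoal : bombieriMinWeight s g - ∑ k ∈ Finset.range N, g (1 / w (k + 1)) *
      (roughCellDensity s (w (k + 1)) - roughCellDensity s (w k)) =
      ∑ k ∈ Finset.range N, ∫ t in (w k)..(w (k + 1)),
        (g (1 / t) * kernel s t - g (1 / w (k + 1)) * kernel s t) := by
    rw [hΦ, ← hadj, ← Finset.sum_sub_distrib]
    refine Finset.sum_congr rfl fun k _ => ?_
    rw [hI k, ← intervalIntegral.integral_const_mul, ← intervalIntegral.integral_sub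
      (intervalIntegrable_integrand hs hg hgη (hw1 k) (hw1 (k + 1)))
      ((intervalIntegrable_kernel hs _ _).const_mul _)]
  show |bombieriMinWeight s g - ∑ k ∈ Finset.range N, g (1 / w (k + 1)) *
      (roughCellDensity s (w (k + 1)) - roughCellDensity s (w k))| ≤ ε * roughCellDensity s M
  rw [hgoal]
  refine (Finset.abs_sum_le_sum_abs _ _).trans ?_
  have hbound : ∀ k ∈ Finset.range N,
      |∫ t in (w k)..(w (k + 1)), (g (1 / t) * kernel s t - g (1 / w (k + 1)) * kernel s t)| ≤
        ε * (roughCellDensity s (w (k + 1)) - roughCellDensity s (w k)) := by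
    intro k hk
    have hkN : k + 1 ≤ N := Finset.mem_range.mp hk
    have hle : w k ≤ w (k + 1) := by rw [hwsucc]; linarith
    refine (intervalIntegral.abs_integral_le_integral_abs hle).trans ?_
    rw [hI k, ← intervalIntegral.integral_const_mul]
    refine intervalIntegral.integral_mono_on hle
      ((intervalIntegrable_integrand hs hg hgη (hw1 k) (hw1 (k + 1))).sub
        ((intervalIntegrable_kernel hs _ _).const_mul _)).abs
      ((intervalIntegrable_kernel hs _ _).const_mul _) fun t ht => ?_
    rw [← sub_mul, abs_mul, abs_of_nonneg (kernel_nonneg hs t)]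
    refine mul_le_mul_of_nonneg_right ?_ (kernel_nonneg hs t)
    refine hτ t ⟨(hw1 k).trans ht.1, ht.2.trans (hwM (k + 1) hkN)⟩ (w (k + 1))
      ⟨hw1 _, hwM _ hkN⟩ ?_
    rw [abs_sub_comm, abs_of_nonneg (by linarith [ht.2])]
    rw [hwsucc] at ht ⊢
    linarith [ht.1]
  calc ∑ k ∈ Finset.range N,
        |∫ t in (w k)..(w (k + 1)), (g (1 / t) * kernel s t - g (1 / w (k + 1)) * kernel s t)|
      ≤ ∑ k ∈ Finset.range N, ε * (roughCellDensity s (w (k + 1)) - roughCellDensity s (w k)) :=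
        Finset.sum_le_sum hbound
    _ = ε * (roughCellDensity s (w N) - roughCellDensity s (w 0)) := by
        rw [← Finset.mul_sum]
        congr 1
        exact Finset.sum_range_sub (fun k => roughCellDensity s (w k)) N
    _ = ε * roughCellDensity s M := by
        have h0 : roughCellDensity s (w 0) = 0 := by
          refine roughCellDensity_of_le hs ?_
          simp only [hw, Nat.cast_zero, zero_mul, add_zero]
          exact_mod_cast (by omega : 1 ≤ s)
        have hN : w N = M := by simp only [hw]; exact hNΔ
        rw [h0, sub_zero, hN]

/-- Real-arithmetic core of the Stieltjes step: the three error terms (sum side, cells, weight side)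
add up to at most `c A(x)/log x`. [folklore] -/
theorem stieltjes_core {N : ℕ} {U I c : ℕ → ℝ} {S Φ Mx AL ε₁ ε₂ K₃ B cc : ℝ}
    (hsum : |S - ∑ k ∈ Finset.range N, c k * (U (k + 1) - U k)| ≤ ε₁ * U N)
    (hwt : |Φ - ∑ k ∈ Finset.range N, c k * (I (k + 1) - I k)| ≤ ε₁ * I N)
    (hcell : ∀ k ∈ Finset.range (N + 1), |U k - I k * Mx| ≤ ε₂ * AL)
    (hMx : |Mx| ≤ K₃ * AL) (hcB : ∀ k ∈ Finset.range N, |c k| ≤ B)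
    (hI0 : 0 ≤ I N) (hAL : 0 ≤ AL) (hε₁ : 0 ≤ ε₁) (hε₂1 : ε₂ ≤ 1) (hB : 0 ≤ B)
    (hb1 : ε₁ * (2 * I N * K₃ + 1) ≤ cc / 2) (hb2 : 4 * (N * B) * ε₂ ≤ cc) :
    |S - Φ * Mx| ≤ cc * AL := by
  have hUN : U N ≤ I N * K₃ * AL + ε₂ * AL := by
    have h1 := (abs_le.mp (hcell N (Finset.self_mem_range_succ N))).2
    have h2 : I N * Mx ≤ I N * (K₃ * AL) :=
      mul_le_mul_of_nonneg_left ((le_abs_self _).trans hMx) hI0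
    linarith
  have hT1 : |S - ∑ k ∈ Finset.range N, c k * (U (k + 1) - U k)| ≤
      ε₁ * (I N * K₃ * AL + ε₂ * AL) := hsum.trans (mul_le_mul_of_nonneg_left hUN hε₁)
  have hT2 : |∑ k ∈ Finset.range N, c k * ((U (k + 1) - U k) - (I (k + 1) - I k) * Mx)| ≤
      N * (B * (2 * ε₂ * AL)) := by
    refine (Finset.abs_sum_le_sum_abs _ _).trans ?_
    have h : ∀ k ∈ Finset.range N,
        |c k * ((U (k + 1) - U k) - (I (k + 1) - I k) * Mx)| ≤ B * (2 * ε₂ * AL) := by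
      intro k hk
      have hk' := Finset.mem_range.mp hk
      rw [abs_mul]
      refine mul_le_mul (hcB k hk) ?_ (abs_nonneg _) hB
      have hk1 := hcell (k + 1) (Finset.mem_range.mpr (by omega))
      have hk0 := hcell k (Finset.mem_range.mpr (by omega))
      rw [show (U (k + 1) - U k) - (I (k + 1) - I k) * Mx =
        (U (k + 1) - I (k + 1) * Mx) - (U k - I k * Mx) by ring]
      refine (abs_sub _ _).trans ?_
      linarith
    refine (Finset.sum_le_sum h).trans ?_
    rw [Finset.sum_const, Finset.card_range, nsmul_eq_mul]
  have hT3 : |(∑ k ∈ Finset.range N, c k * (I (k + 1) - I k) - Φ) * Mx| ≤ ε₁ * I N * (K₃ * AL) := by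
    rw [abs_mul, abs_sub_comm]
    exact mul_le_mul hwt hMx (abs_nonneg _) (mul_nonneg hε₁ hI0)
  have e2 : ∑ k ∈ Finset.range N, c k * ((U (k + 1) - U k) - (I (k + 1) - I k) * Mx) =
      ∑ k ∈ Finset.range N, c k * (U (k + 1) - U k) -
        (∑ k ∈ Finset.range N, c k * (I (k + 1) - I k)) * Mx := by
    rw [Finset.sum_mul, ← Finset.sum_sub_distrib]
    exact Finset.sum_congr rfl fun k _ => by ring
  have e : S - Φ * Mx = (S - ∑ k ∈ Finset.range N, c k * (U (k + 1) - U k)) +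
      ∑ k ∈ Finset.range N, c k * ((U (k + 1) - U k) - (I (k + 1) - I k) * Mx) +
      (∑ k ∈ Finset.range N, c k * (I (k + 1) - I k) - Φ) * Mx := by
    rw [e2]; ring
  rw [e]
  refine (abs_add_three _ _ _).trans ?_
  have h1 : ε₁ * ε₂ * AL ≤ ε₁ * AL :=
    mul_le_mul_of_nonneg_right (mul_le_of_le_one_right hε₁ hε₂1) hAL
  have h2 : ε₁ * (2 * I N * K₃ + 1) * AL ≤ cc / 2 * AL := mul_le_mul_of_nonneg_right hb1 hAL
  have h3 : 4 * (N * B) * ε₂ * AL ≤ cc * AL := mul_le_mul_of_nonneg_right hb2 hAL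
  linarith

/-- **Bombieri's law on `P_s`, min form, from the vector sieve** (`s ≥ 2`): for `g` continuous and
vanishing on `(−∞, η]` (`η > 0`), `S_s(g; x) = Φ_s(g) M_s(x) + o(A(x)/log x)` with
`Φ_s(g) = bombieriMinWeight s g`. Proof: Stieltjes approximation of `g(1/v)` by step functions of
`v = log n/log p_min(n)` on the partition `w_k = 1 + kΔ` of `[1, M]`, `M = max(2, 1/η)`
(`prSum_step_approx`, `weight_step_approx`), cell by cell by `vMass_law`. [folklore] -/
theorem prSum_law (hV : Bombieri1976_asymptotic_sieve_vector) {A : SieveSequence} {H : ℝ}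
    (hA : A.IsBombieriSequence) (hH : A.HasDensityConstant H) {s : ℕ} (hs : 2 ≤ s) {g : ℝ → ℝ}
    (hg : Continuous g) {η : ℝ} (hη : 0 < η) (hgη : ∀ u, u ≤ η → g u = 0) :
    (fun x : ℝ => prSum A s g x - bombieriMinWeight s g * mainTerm A H s x) =o[atTop]
      fun x : ℝ => A.size x / Real.log x := by
  have hsize := hA.1
  rw [isLittleO_iff]
  intro cc hcc
  -- constants: `M`, `K₃`, `B`, `ε₁`, `τ`, `N`, `Δ`, `ε₂`
  set M : ℝ := max 2 (1 / η) with hM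
  have hM2 : 2 ≤ M := le_max_left _ _
  have hM1 : 1 ≤ M := by linarith
  have hMη : 1 / η ≤ M := le_max_right _ _
  obtain ⟨K₃, hK₃0, hK₃⟩ := abs_mainTerm_eventually hA hH s
  obtain ⟨B, hB0, hB⟩ := exists_bound_comp_inv hg hgη
  have hIM0 : 0 ≤ roughCellDensity s M := roughCellDensity_nonneg _ _
  have hden : 0 < 2 * roughCellDensity s M * K₃ + 1 := by positivity
  set ε₁ : ℝ := cc / (2 * (2 * roughCellDensity s M * K₃ + 1)) with hε₁
  have hε₁0 : 0 < ε₁ := by positivity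
  have hb1 : ε₁ * (2 * roughCellDensity s M * K₃ + 1) ≤ cc / 2 := by
    refine le_of_eq ?_
    rw [hε₁]
    field_simp
  obtain ⟨τ, hτ0, hτ⟩ := unifCont_comp_inv hg (M := M) hε₁0
  set N : ℕ := ⌈(M - 1) / τ⌉₊ with hN
  have hN1 : 0 < N := Nat.ceil_pos.mpr (div_pos (by linarith) hτ0)
  have hN0 : (0 : ℝ) < N := Nat.cast_pos.mpr hN1
  set Δ : ℝ := (M - 1) / N with hΔ
  have hΔ0 : 0 < Δ := div_pos (by linarith) hN0
  have hNΔ : 1 + N * Δ = M := by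
    rw [hΔ]
    field_simp
    ring
  have hΔτ : Δ ≤ τ := by
    rw [hΔ, div_le_iff₀ hN0]
    have h := Nat.le_ceil ((M - 1) / τ)
    rw [← hN, div_le_iff₀ hτ0] at h
    linarith
  set ε₂ : ℝ := min 1 (cc / (4 * (N * B + 1))) with hε₂
  have hε₂0 : 0 < ε₂ := lt_min one_pos (by positivity)
  have hε₂1 : ε₂ ≤ 1 := min_le_left _ _
  have hb2 : 4 * (N * B) * ε₂ ≤ cc := by
    have h1 : ε₂ ≤ cc / (4 * (N * B + 1)) := min_le_right _ _
    rw [le_div_iff₀ (by positivity)] at h1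
    nlinarith [hε₂0.le]
  -- the cell laws at all `w_k`, `k ≤ N`, eventually
  have hcells : ∀ᶠ x : ℝ in atTop, ∀ k ∈ Finset.range (N + 1),
      |(∑ n ∈ (Ps s x).filter
          (fun n : ℕ => Real.log n / Real.log (Nat.minFac n) ≤ 1 + k * Δ), A.a n) -
        roughCellDensity s (1 + k * Δ) * mainTerm A H s x| ≤ ε₂ * (A.size x / Real.log x) := by
    rw [Filter.eventually_all_finset]
    intro k _
    have h1k : (1 : ℝ) ≤ 1 + k * Δ := by
      have : (0 : ℝ) ≤ k * Δ := by positivity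
      linarith
    filter_upwards [(vMass_law hV hA hH hs h1k).def hε₂0, eventually_gt_atTop 1] with x hx hx1
    have hAL : 0 ≤ A.size x / Real.log x :=
      div_nonneg (SieveSequence.size_nonneg_of_size_eq hsize x) (Real.log_nonneg hx1.le)
    rwa [Real.norm_eq_abs, Real.norm_eq_abs, abs_of_nonneg hAL] at hx
  filter_upwards [hcells, hK₃, eventually_gt_atTop 1] with x hcell hMx hx1
  have hAL : 0 ≤ A.size x / Real.log x :=
    div_nonneg (SieveSequence.size_nonneg_of_size_eq hsize x) (Real.log_nonneg hx1.le)
  rw [Real.norm_eq_abs, Real.norm_eq_abs, abs_of_nonneg hAL]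
  have hsum := prSum_step_approx hs hη hgη hMη hΔ0 hNΔ hτ hΔτ A hx1
  have hwt := weight_step_approx hs hg hη hgη hM1 hMη hΔ0 hNΔ hτ hΔτ
  have hMx' : |mainTerm A H s x| ≤ K₃ * (A.size x / Real.log x) := by
    rw [← mul_div_assoc]; exact hMx
  refine stieltjes_core (N := N)
    (U := fun k => ∑ n ∈ (Ps s x).filter
      (fun n : ℕ => Real.log n / Real.log (Nat.minFac n) ≤ 1 + k * Δ), A.a n)
    (I := fun k => roughCellDensity s (1 + k * Δ))
    (c := fun k => g (1 / (1 + ((k + 1 : ℕ) : ℝ) * Δ)))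
    hsum ?_ hcell hMx' ?_ (roughCellDensity_nonneg _ _) hAL hε₁0.le hε₂1 hB0 ?_ hb2
  · simpa only [hNΔ] using hwt
  · intro k _
    refine hB _ ?_
    have : (0 : ℝ) ≤ ((k + 1 : ℕ) : ℝ) * Δ := by positivity
    linarith
  · simpa only [hNΔ] using hb1

end BombieriPr

/-- **Bombieri's asymptotic sieve on `P_r`, every `r ≥ 2`, for test functions of the smallest prime
factor — DISCHARGED.** The named fact `Bombieri1976_PrDistributionMin` ([BombieriRIMS1977] p. 5
Theorem, test functions `G(u) = g(u₁)`, `g` continuous vanishing on `(−∞, η]`) holds: by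
`BombieriPr.prSum_law` (the deduction from the vector form of Bombieri's Theorem 1 along
[FriedlanderIwaniecPisa1978] p. 723 Remark 4: polynomial product weights, comparison with the
integers, Alladi's theorem for the integers, rough cells, Stieltjes approximation) applied to the
tree's `Bombieri1976_asymptotic_sieve_vector_holds`.
[cite: BombieriRIMS1977, p. 5 Theorem (every r); definitions pp. 4-5; meaning of ∼ p. 6 Corollary] -/
theorem Bombieri1976_PrDistributionMin_holds : Bombieri1976_PrDistributionMin := by
  intro A H hA hH r hr g hg hη
  obtain ⟨η, hη0, hgη⟩ := hη
  have h := BombieriPr.prSum_law Bombieri1976_asymptotic_sieve_vector_holds hA hH hr hg hη0 hgη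
  refine h.congr' (Eventually.of_forall fun x => ?_) EventuallyEq.rfl
  simp only [BombieriRoughCells.prSum, BombieriRoughCells.mainTerm]
  ring

end Literature.NumberTheory.Sieve

end
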